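import Literature.Claims.NS.Zhong2026
import Summits.NavierStokesRegularity.NavierStokesRegularity.Theorems.SoloSalvagePermana2026
import Literature.Analysis.FluidPDE.NSVorticityBKMProofs
import HarnessLib

/-!
# Solo salvage for claim C161 `Zhong2026` (cell `ns-claims`, D-0090): the BKM step is TRUE

Claim C161: skeleton `Literature.Claims.NS.Zhong2026` (typist-9 g5). Its `Step_BKM` (proof of Thm 6.2 p.8
l.38–39, «by the BKM blow-up criterion [8]»): in the `Chae2007` class, a uniform sup-vorticity bound on `[0,T)`
excludes `H³` blow-up at `T`. TRUE (Beale–Kato–Majda 1984); discharged here from the tree's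
`MajdaBertozzi2002_bkmAprioriH3_holds` (finite BKM integral ⇒ bounded `Σ_{n≤3}∫‖Dⁿu‖²` on `[0,T)`) and the
bookkeeping `…Theorems.Permana2026Salvage.step_9_holds` (a continuous majorant of `‖ω(t)‖_∞` — here the constant
`B` — makes `∫⁻_{(0,T)} ⨆ₓ‖ω‖ₑ` finite).

Salvage seat `ns-claims-salvage-p1` g3 (solo lane; no statement item; the located step of the verdict is
untouched — TRUE column).

WHAT THIS IS NOT: not a claim about NS regularity or blow-up; not a claim about any author beyond the typed
locator.
-/

set_option linter.dupNamespace false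

noncomputable section

open Set Filter MeasureTheory Topology
open scoped ENNReal NNReal

namespace Summit.NavierStokesRegularity.NavierStokesRegularity.Theorems.Zhong2026Salvage

open Literature.Analysis.FluidPDE
open Literature.Claims.NS.Chae2007 (IsLocalSolution BlowsUpAt)

/-- **`Step_BKM` of C161 holds**: along a `Chae2007.IsLocalSolution` on `[0,T)` with `ν > 0`, a uniform bound
`‖ω(t,x)‖ ≤ B` on `[0,T) × ℝ³` excludes `BlowsUpAt T u`. [cite: Zhong2026, proof of Theorem 6.2 p.8 l.38–39]
[cite: BealeKatoMajda1984, Thm 1] -/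
theorem step_BKM_holds : Literature.Claims.NS.Zhong2026.Step_BKM := by
  intro ν hν T hT v₀ u p hsol hB hblow
  obtain ⟨B, hBle⟩ := hB
  -- the constant majorant bounds the skeleton's `supVort`
  have hsup : ∀ t ∈ Ico 0 T, Literature.Claims.NS.Permana2026.supVort u t ≤ max B 0 := by
    intro t ht
    unfold Literature.Claims.NS.Permana2026.supVort
    have hle : (⨆ x, ‖curl (u t) x‖ₑ) ≤ ENNReal.ofReal (max B 0) := by
      refine iSup_le fun x => ?_
      rw [← ofReal_norm]
      exact ENNReal.ofReal_le_ofReal ((hBle t ht x).trans (le_max_left _ _))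
    have h := ENNReal.toReal_mono ENNReal.ofReal_ne_top hle
    rwa [ENNReal.toReal_ofReal (le_max_right _ _)] at h
  -- finite BKM integral (Permana Step 9 bookkeeping with the constant majorant)
  have hfin : (∫⁻ t in Ioo 0 T, ⨆ x, ‖curl (u t) x‖ₑ) < ⊤ :=
    Permana2026Salvage.step_9_holds ν hν T hT v₀ u p hsol (fun _ => max B 0) continuousOn_const hsup
  -- BKM a-priori `H³` bound
  obtain ⟨A, hA⟩ := MajdaBertozzi2002_bkmAprioriH3_holds hν.le hT hsol.isClassical hsol.sobolev hfin
  exact hblow ⟨A, hA⟩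

end Summit.NavierStokesRegularity.NavierStokesRegularity.Theorems.Zhong2026Salvage

end
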